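import Literature.NumberTheory.Transcendental.KZLogCalculusProofs
import Literature.NumberTheory.Transcendental.KZMellinFibres
import Literature.NumberTheory.Transcendental.KZDominatedFamilyRelations
import Summits.KontsevichZagierPeriods.KontsevichZagierPeriods.Theorems.HurwitzMicroSectorsNormalFormPrincipleLevelOneExistsRep

/-!
# `NormalFormPrinciple` (stmt-KontsevichZagierPeriods-3869), line `SketchIdeator1` — leaf `stub_boxRigidity`,
# dimension two off the product type (`FiveZetaTwoOffProduct`): dilation of the base of a log monomial

Registered sub-goal `logMonomial_dilate` of the layer `FiveZetaTwoOffProduct` (lead file `…M2`).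
For the unfolded log monomials `M(g, v) = [{(x, s) : 0 < x < 1, 1 ≤ s ≤ v x}, g(x)/s]` over `(0,1)`:
if `R` lives on the band of `M(c/x, v(x^(k+1)))` with integrand `(c/x)/s` there and `R'` on the band of
`M(c/((k+1)u), v u)` with integrand `(c/((k+1)u))/s` there, then `[R] − [R'] ∈ KZ.relations`.
The move is rule (2) for the polynomial map `Φ(x, s) = (x^(k+1), s) = KZ.boxDilation 0 k (x, s)`
(Jacobian `(k+1)xᵏ`, injective on `{x > 0}`), packaged in the tree as
`KZ.of_sub_of_mem_relations_of_boxDilation`; what is checked here is the set identity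
`Φ(band of v(x^(k+1))) = band of v` (surjectivity through the `(k+1)`-th root of `u ∈ (0,1)`) and the
pointwise identity `(c/x)/s = (c/((k+1)x^(k+1)))/s · (k+1)xᵏ` on the band (`x > 0`, `s ≥ 1`).
References: M. Kontsevich, D. Zagier, *Periods* (2001), §1.2 rule (2). No definitions are introduced.
-/

noncomputable section

open MeasureTheory Set
open Literature.NumberTheory.Transcendental Literature.NumberTheory.Transcendental.KZ
open Literature.ModelTheory.ExponentialFields (IsSemialgebraic)

namespace Summit.KontsevichZagierPeriods.HurwitzMicroSectors.NormalFormPrinciple.PiBox.M2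

/-- **Stub D (dilation of the base lifted to unfolded log monomials, rule (2)).** If `R` is a
representation on the band `{0 < x < 1, 1 ≤ s ≤ v(x^(k+1))}` whose integrand is `(c/x)/s` there, and
`R'` one on the band `{0 < u < 1, 1 ≤ s ≤ v u}` whose integrand is `(c/((k+1)u))/s` there, then
`[R] − [R'] ∈ KZ.relations`: one change of variables along the box dilation
`(x, s) ↦ (x^(k+1), s)` (`KZ.boxDilation 0 k`, Jacobian `(k+1)xᵏ`), i.e.
`M(c/x, v(x^(k+1))) ≡ M(c/((k+1)u), v u)`. No hypothesis on `v` is needed.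
[cite: KontsevichZagier2001, §1.2 rule (2)] -/
theorem logMonomial_dilate (k : ℕ) (c : ℝ) (v : ℝ → ℝ) (R R' : IntegralRep 2)
    (hRd : R.domain = KZlog.band {y : Fin 1 → ℝ | 0 < y 0 ∧ y 0 < 1} (fun _ => (1:ℝ))
      (fun y => v (y 0 ^ (k + 1))))
    (hRi : EqOn R.integrand (fun z => (c / z 0) / z 1) R.domain)
    (hR'd : R'.domain = KZlog.band {y : Fin 1 → ℝ | 0 < y 0 ∧ y 0 < 1} (fun _ => (1:ℝ)) (fun y => v (y 0)))
    (hR'i : EqOn R'.integrand (fun z => (c / ((k + 1 : ℕ) * z 0)) / z 1) R'.domain) :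
    of R - of R' ∈ relations := by
  -- membership in the two bands, with the two coordinates of `ℝ²` spelled out
  -- (`Fin.init z 0 = z 0` and `z (Fin.last 1) = z 1` hold by `rfl`)
  have memR : ∀ z : Fin 2 → ℝ,
      z ∈ R.domain ↔ (0 < z 0 ∧ z 0 < 1) ∧ 1 ≤ z 1 ∧ z 1 ≤ v (z 0 ^ (k + 1)) := fun z => by
    rw [hRd]
    exact Iff.rfl
  have memR' : ∀ z : Fin 2 → ℝ,
      z ∈ R'.domain ↔ (0 < z 0 ∧ z 0 < 1) ∧ 1 ≤ z 1 ∧ z 1 ≤ v (z 0) := fun z => by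
    rw [hR'd]
    exact Iff.rfl
  -- the two coordinates of the dilated point `Φ z = (z₀^(k+1), z₁)`
  have h10 : (1 : Fin 2) ≠ 0 := by decide
  have dil0 : ∀ z : Fin 2 → ℝ, boxDilation 0 k z 0 = z 0 ^ (k + 1) := fun z =>
    boxDilation_apply_self 0 k z
  have dil1 : ∀ z : Fin 2 → ℝ, boxDilation 0 k z 1 = z 1 := fun z =>
    boxDilation_apply_of_ne k h10 z
  -- the set identity `R'.domain = Φ '' R.domain`
  have hd : R'.domain = boxDilation 0 k '' R.domain := by
    ext z
    rw [memR', mem_image]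
    constructor
    · rintro ⟨⟨h0, h1⟩, h2, h3⟩
      -- the `(k+1)`-th root `x` of `z₀ ∈ (0,1)` lies in `(0,1)`, and `Φ (x, z₁) = z`
      obtain ⟨x, hxk, hx0, hx1⟩ : ∃ x : ℝ, x ^ (k + 1) = z 0 ∧ 0 < x ∧ x < 1 :=
        ⟨z 0 ^ (((k + 1 : ℕ) : ℝ)⁻¹), Real.rpow_inv_natCast_pow h0.le (Nat.succ_ne_zero k),
          Real.rpow_pos_of_pos h0 _,
          Real.rpow_lt_one h0.le h1 (inv_pos.2 (Nat.cast_pos.2 (Nat.succ_pos k)))⟩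
      obtain ⟨z', e0, e1⟩ : ∃ z' : Fin 2 → ℝ, z' 0 = x ∧ z' 1 = z 1 :=
        ⟨fun i => if i = 0 then x else z i, if_pos rfl, if_neg h10⟩
      refine ⟨z', (memR z').2 ?_, funext fun i => ?_⟩
      · rw [e0, e1, hxk]
        exact ⟨⟨hx0, hx1⟩, h2, h3⟩
      · fin_cases i
        · simpa [dil0, e0] using hxk
        · simp [dil1, e1]
    · rintro ⟨x, hx, rfl⟩
      obtain ⟨⟨h0, h1⟩, h2, h3⟩ := (memR x).1 hx
      rw [dil0, dil1]
      exact ⟨⟨pow_pos h0 _, pow_lt_one₀ h0.le h1 (Nat.succ_ne_zero k)⟩, h2, h3⟩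
  -- one move of rule (2): the box dilation `Φ = boxDilation 0 k`, Jacobian `(k+1) x₀ᵏ`
  refine of_sub_of_mem_relations_of_boxDilation 0 k (fun x hx => ((memR x).1 hx).1.1) hd
    fun x hx => ?_
  have hx' : boxDilation 0 k x ∈ R'.domain := by
    rw [hd]
    exact mem_image_of_mem _ hx
  obtain ⟨⟨h0, -⟩, h2, -⟩ := (memR x).1 hx
  have hx0 : x 0 ≠ 0 := h0.ne'
  have hx1 : x 1 ≠ 0 := (one_pos.trans_le h2).ne'
  have hk : ((k + 1 : ℕ) : ℝ) ≠ 0 := Nat.cast_ne_zero.2 (Nat.succ_ne_zero k)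
  rw [hRi hx, hR'i hx']
  simp only [dil0, dil1]
  field_simp
  ring

end Summit.KontsevichZagierPeriods.HurwitzMicroSectors.NormalFormPrinciple.PiBox.M2
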